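import Summits.ResolutionOfSingularities.ResolutionOfSingularities.Theorems.EquisingularLiftEquisingularLiftNatEquinodalNoseDatumOfSections
import Summits.ResolutionOfSingularities.ResolutionOfSingularities.Theorems.EquisingularLiftEquisingularLiftNatEquinodalNoseModel
import Summits.ResolutionOfSingularities.ResolutionOfSingularities.Theorems.EquisingularLiftEquisingularLiftNatEquinodalLetterModel
import Summits.ResolutionOfSingularities.ResolutionOfSingularities.Theorems.EquisingularLiftEquisingularLiftNatEquinodalHostNormalForm
import Summits.ResolutionOfSingularities.ResolutionOfSingularities.Theorems.EquisingularLiftEquisingularLiftNatEquinodalHyperplaneLift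
import Summits.ResolutionOfSingularities.ResolutionOfSingularities.Theorems.EquisingularLiftEquisingularLiftNatEquinodalLiftOfCertResidue
import Summits.ResolutionOfSingularities.ResolutionOfSingularities.Theorems.EquisingularLiftEquisingularLiftNatFibreIntegral
import HarnessLib

/-!
# [OURS · L1 W4.5(b) · EL♮(3) · door ν4, brick N-0 (JINIT at `RD := RPlus`)] CONDITIONAL ASSEMBLY, LEVEL B v2 — ★ `noseDatum_initial_of_sections₂`:
# the core `hND` of ✓ `jinit_rPlus₀_of_noseDatum₂` REDUCED TO ONE core «SECTIONS» (`W5`, `S1`–`S8` of `NoseDatum`) over CONCRETE data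

res-L1-w45b-nose-w1 g4 (WIDTH seat D-0157 DOOR 1; N-0 owner).  DEF-FREE; no `sorry`; standard axioms.  `--supports stmt-ResolutionOfSingularities-20148
--as helper`, counted 0.

v2 = ✓ `noseDatum_initial_of_sections` with ONE MORE binder handed to the core: `Function.Injective v` (the marked vectors are pairwise distinct — derived here from the
SURJECTIVITY of (CERT-EQ); without it the core's `Function.Injective w` conjunct is not provable).  WHAT.  The statement of `noseDatum_initial_of_sections₂` is `hND` of ✓ `jinit_rPlus₀_of_noseDatum₂` VERBATIM (the N-0 core of record, desk BOOKINGS 2 (a)),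
under ONE hypothesis `coreS` whose binders are the CONCRETE objects a worker computes with: the door's `ℓ, Z` and the unpacked certificate
(`e δ g B c a b v r` + clauses of `EqCertAt₀`), the lifted hyperplane data of ✓ `HyperplaneLift.exists_hyperplane_lift` (`a₀ B̃ c̃ Ñ` + clauses, and
`V₊(ℓ) = V₊(θL̃)` from ✓ `HostNormalForm`), the equinodal lift of ✓ `exists_equinodal_lift_of_cert_of_surjective` (`G̃ nO` + clauses), and the degree
certificates `hL hF` of the two models `𝓛₀ := (![L̃])~`, `𝓦₀ := (![L̃, Ĝ])~` (`Ĝ := G̃(Ñ x_r)`); its conclusion = the SECTIONS HALF of `NoseDatum`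
(`W5` regular off the sections, `S1`–`S8`).  DISCHARGED HERE (kernel): the extraction of all that data, the LETTER clauses `L1`–`L5`
(✓ `LetterModel.letter_clauses_projIdealSheaf`, trace moved from `V₊(θL̃)` to `V₊(ℓ)`), `W1` (✓ `letter_le_nose`), `W2` the reduced trace `𝓘⟨Z⟩`
(✓ `NoseModel.comap_eq_vanishingIdeal_of_isRadical` + pair algebra), `W3` flat (✓ `flat_nose`), `W4` integral (res-L1-w45b-stub-4 ✓ p679360
`FibreIntegral.isIntegral_subscheme_of_flat_of_comap_eq_vanishingIdeal` on the base model square ✓ `ProjectiveAmbientFibre.isPullback_projMap`).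
So N-0 = `coreS` exactly (ring core for `W5`/`S8`: ✓ …NatEquinodalNodeRegularCore/Taylor; junction ✓ `nodeChart_hypotheses`).
EL♮(3) is NOT proved; resolution of singularities in positive characteristic is NOT proved.
-/

set_option linter.dupNamespace false -- mandated namespace `Summit.<Summit>.<Problem>` of this single-conjunct summit
set_option linter.overlappingInstances false -- signatures carry `[IsDomain O] [IsDiscreteValuationRing O]`

noncomputable section

open CategoryTheory CategoryTheory.Limits AlgebraicGeometry TopologicalSpace Topology IsLocalRing
open MvPolynomial
open Literature.AlgebraicGeometry.Resolution
open AlgebraicGeometry.Scheme.IdealSheafData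
open Summit.ResolutionOfSingularities.ResolutionOfSingularities.Theses.EquisingularLift.Split
open Summit.ResolutionOfSingularities.ResolutionOfSingularities.Cruxes.EquisingularLift.StrataSplit

namespace Summit.ResolutionOfSingularities.ResolutionOfSingularities.Cruxes.EquisingularLiftNat.Sections.Equinodal

/-- ★ **N-0, CONDITIONAL ASSEMBLY — LEVEL B v2** (core also receives `Function.Injective v`).  `hND` of ✓ `jinit_rPlus₀_of_noseDatum₂` from the single core `coreS` (the SECTIONS half of `NoseDatum`
over concrete data); the letter, `𝓛 ≤ 𝓦`, the reduced trace, flatness and integrality of the nose model are discharged.  See the module docstring.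
[OURS · brick N-0 · conditional assembly; counted 0] -/
theorem noseDatum_initial_of_sections₂ (k : Type) [Field k] [IsAlgClosed k] (H : Scheme.{0})
    (ι : H ⟶ (Literature.AlgebraicGeometry.Motives.projectiveSpace 3 k).left)
    (hι : AlgebraicGeometry.IsClosedImmersion ι) (hH : AlgebraicGeometry.IsIntegral H)
    (coreS : ∀ (O : Type) [CommRing O] [IsDomain O] [IsDiscreteValuationRing O] [IsAdicComplete (IsLocalRing.maximalIdeal O) O]
        [IsAlgClosed (IsLocalRing.ResidueField O)] (θ : O →+* k), Function.Surjective θ →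
      (letI := MvPolynomial.gradedAlgebra (σ := Fin (3 + 1)) (R := O); letI := MvPolynomial.gradedAlgebra (σ := Fin (3 + 1)) (R := k);
       ∀ (φ : MvPolynomial.homogeneousSubmodule (Fin (3 + 1)) O →+*ᵍ MvPolynomial.homogeneousSubmodule (Fin (3 + 1)) k)
        (hφ' : HomogeneousIdeal.irrelevant (MvPolynomial.homogeneousSubmodule (Fin (3 + 1)) k) ≤ (HomogeneousIdeal.irrelevant (MvPolynomial.homogeneousSubmodule (Fin (3 + 1)) O)).map φ), (∀ s, φ s = MvPolynomial.map θ s) →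
        AlgebraicGeometry.IsIntegral (AlgebraicGeometry.Proj (MvPolynomial.homogeneousSubmodule (Fin (3 + 1)) O)) → IsLocallyNoetherian (AlgebraicGeometry.Proj (MvPolynomial.homogeneousSubmodule (Fin (3 + 1)) O)) → Literature.AlgebraicGeometry.Resolution.Scheme.IsRegular (AlgebraicGeometry.Proj (MvPolynomial.homogeneousSubmodule (Fin (3 + 1)) O)) → AlgebraicGeometry.IsProper (AlgebraicGeometry.Proj.toSpecZero (MvPolynomial.homogeneousSubmodule (Fin (3 + 1)) O) ≫ AlgebraicGeometry.Spec.map (CommRingCat.ofHom (algebraMap O (MvPolynomial.homogeneousSubmodule (Fin (3 + 1)) O 0)))) → AlgebraicGeometry.SmoothOfRelativeDimension 3 (AlgebraicGeometry.Proj.toSpecZero (MvPolynomial.homogeneousSubmodule (Fin (3 + 1)) O) ≫ AlgebraicGeometry.Spec.map (CommRingCat.ofHom (algebraMap O (MvPolynomial.homogeneousSubmodule (Fin (3 + 1)) O 0)))) →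
      -- the door's `ℓ`, `Z` and the CERTIFICATE data (`EqCertAt₀ k 3 ℓ Z hZ` unpacked)
      ∀ (ℓ : MvPolynomial (Fin (3 + 1)) k) (Z : Set (Literature.AlgebraicGeometry.Motives.projectiveSpace 3 k).left) (hZ : IsClosed Z) (e δ : ℕ) (g : MvPolynomial (Fin (3 + 1)) k)
        (B : Fin (3 + 1) → Fin 3 → k) (c a b : Fin 3) (v : Fin δ → Fin 3 → k) (r : Fin 3 → Fin (3 + 1)),
        g.IsHomogeneous e → Squarefree (restrictToHyperplane B g) →
        Z = {y : (Literature.AlgebraicGeometry.Motives.projectiveSpace 3 k).left | ℓ ∈ (y : ProjectiveSpectrum (MvPolynomial.homogeneousSubmodule (Fin (3 + 1)) k)).asHomogeneousIdeal ∧ g ∈ (y : ProjectiveSpectrum (MvPolynomial.homogeneousSubmodule (Fin (3 + 1)) k)).asHomogeneousIdeal} →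
        restrictToHyperplane B ℓ = 0 → Function.Injective r → ((c : ℕ) = 2 ∧ (a : ℕ) = 0 ∧ (b : ℕ) = 1) →
        (∀ i, v i c = 1 ∧ MvPolynomial.eval (v i) (restrictToHyperplane B g) = 0 ∧
          (∀ j, MvPolynomial.eval (v i) (MvPolynomial.pderiv j (restrictToHyperplane B g)) = 0) ∧ hessBlock (restrictToHyperplane B g) a b (v i) ≠ 0) →
        (∀ z : ↥(redSub (Literature.AlgebraicGeometry.Motives.projectiveSpace 3 k).left Z hZ), IsClosed ({z} : Set ↥(redSub (Literature.AlgebraicGeometry.Motives.projectiveSpace 3 k).left Z hZ)) → ¬ IsRegularLocalRing ((redSub (Literature.AlgebraicGeometry.Motives.projectiveSpace 3 k).left Z hZ).presheaf.stalk z) →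
          ∃ i, IsCoordVecOf k 3 (fun s => ∑ j, B s j * v i j) (redSubι (Literature.AlgebraicGeometry.Motives.projectiveSpace 3 k).left Z hZ z : (Literature.AlgebraicGeometry.Motives.projectiveSpace 3 k).left)) →
        Function.Injective v →
      -- the LIFTED HYPERPLANE data (✓ `HyperplaneLift.exists_hyperplane_lift`)
      ∀ (a₀ : Fin (3 + 1)) (Bt : Fin (3 + 1) → Fin 3 → O) (ct : Fin (3 + 1) → O) (Nt : Fin 3 → Fin 3 → O),
        (∀ j, r j ≠ a₀) → (∀ a' j, θ (Bt a' j) = B a' j) → IsUnit (Matrix.of fun j j' : Fin 3 => Bt (r j) j').det → ct a₀ = 1 →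
        MvPolynomial.aeval (fun a' : Fin (3 + 1) => ∑ j : Fin 3, MvPolynomial.C (Bt a' j) * MvPolynomial.X j) (∑ a, MvPolynomial.C (ct a) * MvPolynomial.X a : MvPolynomial (Fin (3 + 1)) O) = 0 →
        (∀ G : MvPolynomial (Fin 3) O, MvPolynomial.aeval (fun a' : Fin (3 + 1) => ∑ j : Fin 3, MvPolynomial.C (Bt a' j) * MvPolynomial.X j)
          (MvPolynomial.aeval (fun i : Fin 3 => ∑ j : Fin 3, MvPolynomial.C (Nt i j) * MvPolynomial.X (r j)) G) = G) →
        (∀ f : MvPolynomial (Fin (3 + 1)) O, MvPolynomial.aeval (fun a' : Fin (3 + 1) => ∑ j : Fin 3, MvPolynomial.C (Bt a' j) * MvPolynomial.X j) f = 0 → (∑ a, MvPolynomial.C (ct a) * MvPolynomial.X a : MvPolynomial (Fin (3 + 1)) O) ∣ f) →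
        {y : (Literature.AlgebraicGeometry.Motives.projectiveSpace 3 k).left | ℓ ∈ (y : ProjectiveSpectrum (MvPolynomial.homogeneousSubmodule (Fin (3 + 1)) k)).asHomogeneousIdeal} = {y : (Literature.AlgebraicGeometry.Motives.projectiveSpace 3 k).left | (∑ a', MvPolynomial.C (θ (ct a')) * MvPolynomial.X a' : MvPolynomial (Fin (3 + 1)) k) ∈ (y : ProjectiveSpectrum (MvPolynomial.homogeneousSubmodule (Fin (3 + 1)) k)).asHomogeneousIdeal} →
      -- the EQUINODAL LIFT (✓ `exists_equinodal_lift_of_cert_of_surjective`)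
      ∀ (Gt : MvPolynomial (Fin 3) O) (nO : Fin δ → Fin 3 → O),
        Gt.IsHomogeneous e → MvPolynomial.map θ Gt = restrictToHyperplane B g → (∀ i j, θ (nO i j) = v i j) → (∀ i, nO i 2 = 1) →
        (∀ i, MvPolynomial.eval (nO i) Gt = 0 ∧ ∀ j, MvPolynomial.eval (nO i) (MvPolynomial.pderiv j Gt) = 0) →
        (∀ i, IsUnit (MvPolynomial.eval (nO i) (MvPolynomial.pderiv 0 (MvPolynomial.pderiv 0 Gt)) * MvPolynomial.eval (nO i) (MvPolynomial.pderiv 1 (MvPolynomial.pderiv 1 Gt))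
          - MvPolynomial.eval (nO i) (MvPolynomial.pderiv 0 (MvPolynomial.pderiv 1 Gt)) ^ 2)) →
      -- the two models' degree certificates (so the ideal sheaves below are well-formed)
      ∀ (hL : ∀ l, (![(∑ a, MvPolynomial.C (ct a) * MvPolynomial.X a : MvPolynomial (Fin (3 + 1)) O)] : Fin 1 → MvPolynomial (Fin (3 + 1)) O) l ∈ MvPolynomial.homogeneousSubmodule (Fin (3 + 1)) O ((![1] : Fin 1 → ℕ) l))
        (hF : ∀ l, (![(∑ a, MvPolynomial.C (ct a) * MvPolynomial.X a : MvPolynomial (Fin (3 + 1)) O), (MvPolynomial.aeval (fun i : Fin 3 => ∑ j : Fin 3, MvPolynomial.C (Nt i j) * MvPolynomial.X (r j)) Gt : MvPolynomial (Fin (3 + 1)) O)] : Fin 2 → MvPolynomial (Fin (3 + 1)) O) l ∈ MvPolynomial.homogeneousSubmodule (Fin (3 + 1)) O ((![1, e] : Fin 2 → ℕ) l)),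
      -- CONCLUSION: the SECTIONS half of `NoseDatum` for `𝓛₀ := (![L̃])~`, `𝓦₀ := (![L̃, Ĝ])~`
      ∃ (m : ℕ) (𝔰 : Fin m → (AlgebraicGeometry.Spec (.of O) ⟶ (AlgebraicGeometry.Proj (MvPolynomial.homogeneousSubmodule (Fin (3 + 1)) O)))) (w : Fin m → (Literature.AlgebraicGeometry.Motives.projectiveSpace 3 k).left),
        (∀ x : ↥((projIdealSheaf (MvPolynomial.homogeneousSubmodule (Fin (3 + 1)) O) ⟨Ideal.span (Set.range ![(∑ a, MvPolynomial.C (ct a) * MvPolynomial.X a : MvPolynomial (Fin (3 + 1)) O), (MvPolynomial.aeval (fun i : Fin 3 => ∑ j : Fin 3, MvPolynomial.C (Nt i j) * MvPolynomial.X (r j)) Gt : MvPolynomial (Fin (3 + 1)) O)]), isHomogeneous_span_of_forall_mem _ _ _ hF⟩).subscheme), (∀ i, (projIdealSheaf (MvPolynomial.homogeneousSubmodule (Fin (3 + 1)) O) ⟨Ideal.span (Set.range ![(∑ a, MvPolynomial.C (ct a) * MvPolynomial.X a : MvPolynomial (Fin (3 + 1)) O), (MvPolynomial.aeval (fun i :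 Fin 3 => ∑ j : Fin 3, MvPolynomial.C (Nt i j) * MvPolynomial.X (r j)) Gt : MvPolynomial (Fin (3 + 1)) O)]), isHomogeneous_span_of_forall_mem _ _ _ hF⟩).subschemeι x ∉ Set.range (𝔰 i)) →
          IsRegularLocalRing ((projIdealSheaf (MvPolynomial.homogeneousSubmodule (Fin (3 + 1)) O) ⟨Ideal.span (Set.range ![(∑ a, MvPolynomial.C (ct a) * MvPolynomial.X a : MvPolynomial (Fin (3 + 1)) O), (MvPolynomial.aeval (fun i : Fin 3 => ∑ j : Fin 3, MvPolynomial.C (Nt i j) * MvPolynomial.X (r j)) Gt : MvPolynomial (Fin (3 + 1)) O)]), isHomogeneous_span_of_forall_mem _ _ _ hF⟩).subscheme.presheaf.stalk x)) ∧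
        (∀ i, 𝔰 i ≫ 𝟙 (AlgebraicGeometry.Proj (MvPolynomial.homogeneousSubmodule (Fin (3 + 1)) O)) ≫ (AlgebraicGeometry.Proj.toSpecZero (MvPolynomial.homogeneousSubmodule (Fin (3 + 1)) O) ≫ AlgebraicGeometry.Spec.map (CommRingCat.ofHom (algebraMap O (MvPolynomial.homogeneousSubmodule (Fin (3 + 1)) O 0)))) = 𝟙 _) ∧ (∀ i, (projIdealSheaf (MvPolynomial.homogeneousSubmodule (Fin (3 + 1)) O) ⟨Ideal.span (Set.range ![(∑ a, MvPolynomial.C (ct a) * MvPolynomial.X a : MvPolynomial (Fin (3 + 1)) O), (MvPolynomial.aeval (fun i : Fin 3 => ∑ j : Fin 3, MvPolynomial.C (Nt i j) * MvPolynomial.X (r j)) Gt : MvPolynomial (Fin (3 + 1)) O)]), isHomogeneous_span_of_forall_mem _ _ _ hF⟩) ≤ (𝔰 i).ker) ∧ (∀ i, (AlgebraicGeometry.Proj.map φ hφ' : (Literature.AlgebraicGeometry.Motives.projectiveSpace 3 k).left ⟶ (AlgebraicGeometry.Proj (MvPolynomial.homogeneousSubmodule (Fin (3 + 1)) O))) (w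 i) = 𝔰 i (IsLocalRing.closedPoint O)) ∧
        Function.Injective w ∧ (∀ i, w i ∈ Z) ∧ (∀ i, IsClosed ({w i} : Set (Literature.AlgebraicGeometry.Motives.projectiveSpace 3 k).left)) ∧
        (∀ z : ↥(redSub (Literature.AlgebraicGeometry.Motives.projectiveSpace 3 k).left Z hZ), IsClosed ({z} : Set ↥(redSub (Literature.AlgebraicGeometry.Motives.projectiveSpace 3 k).left Z hZ)) →
          (¬ IsRegularLocalRing ((redSub (Literature.AlgebraicGeometry.Motives.projectiveSpace 3 k).left Z hZ).presheaf.stalk z) ↔ ∃ i, (redSubι (Literature.AlgebraicGeometry.Motives.projectiveSpace 3 k).left Z hZ z : (Literature.AlgebraicGeometry.Motives.projectiveSpace 3 k).left) = w i)) ∧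
        (∀ i, SplitNodeAt (AlgebraicGeometry.Proj (MvPolynomial.homogeneousSubmodule (Fin (3 + 1)) O)) (projIdealSheaf (MvPolynomial.homogeneousSubmodule (Fin (3 + 1)) O) ⟨Ideal.span (Set.range ![(∑ a, MvPolynomial.C (ct a) * MvPolynomial.X a : MvPolynomial (Fin (3 + 1)) O)]), isHomogeneous_span_of_forall_mem _ _ _ hL⟩) (projIdealSheaf (MvPolynomial.homogeneousSubmodule (Fin (3 + 1)) O) ⟨Ideal.span (Set.range ![(∑ a, MvPolynomial.C (ct a) * MvPolynomial.X a : MvPolynomial (Fin (3 + 1)) O), (MvPolynomial.aeval (fun i : Fin 3 => ∑ j : Fin 3, MvPolynomial.C (Nt i j) * MvPolynomial.X (r j)) Gt : MvPolynomial (Fin (3 + 1)) O)]), isHomogeneous_span_of_forall_mem _ _ _ hF⟩) (𝔰 i).ker (𝔰 i (IsLocalRing.closedPoint O))))) :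
    ∀ (O : Type) [CommRing O] [IsDomain O] [IsDiscreteValuationRing O] [IsAdicComplete (IsLocalRing.maximalIdeal O) O]
        [IsAlgClosed (IsLocalRing.ResidueField O)] (θ : O →+* k), Function.Surjective θ →
      (letI := MvPolynomial.gradedAlgebra (σ := Fin (3 + 1)) (R := O); letI := MvPolynomial.gradedAlgebra (σ := Fin (3 + 1)) (R := k);
       ∀ (φ : MvPolynomial.homogeneousSubmodule (Fin (3 + 1)) O →+*ᵍ MvPolynomial.homogeneousSubmodule (Fin (3 + 1)) k)
        (hφ' : HomogeneousIdeal.irrelevant (MvPolynomial.homogeneousSubmodule (Fin (3 + 1)) k) ≤ (HomogeneousIdeal.irrelevant (MvPolynomial.homogeneousSubmodule (Fin (3 + 1)) O)).map φ), (∀ s, φ s = MvPolynomial.map θ s) →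
        AlgebraicGeometry.IsIntegral (AlgebraicGeometry.Proj (MvPolynomial.homogeneousSubmodule (Fin (3 + 1)) O)) → IsLocallyNoetherian (AlgebraicGeometry.Proj (MvPolynomial.homogeneousSubmodule (Fin (3 + 1)) O)) → Literature.AlgebraicGeometry.Resolution.Scheme.IsRegular (AlgebraicGeometry.Proj (MvPolynomial.homogeneousSubmodule (Fin (3 + 1)) O)) → AlgebraicGeometry.IsProper (AlgebraicGeometry.Proj.toSpecZero (MvPolynomial.homogeneousSubmodule (Fin (3 + 1)) O) ≫ AlgebraicGeometry.Spec.map (CommRingCat.ofHom (algebraMap O (MvPolynomial.homogeneousSubmodule (Fin (3 + 1)) O 0)))) → AlgebraicGeometry.SmoothOfRelativeDimension 3 (AlgebraicGeometry.Proj.toSpecZero (MvPolynomial.homogeneousSubmodule (Fin (3 + 1)) O) ≫ AlgebraicGeometry.Spec.map (CommRingCat.ofHom (algebraMap O (MvPolynomial.homogeneousSubmodule (Fin (3 + 1)) O 0)))) →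
      ∀ (ℓ : MvPolynomial (Fin (3 + 1)) k), ¬ (Set.range ι ⊆ {y : (Literature.AlgebraicGeometry.Motives.projectiveSpace 3 k).left | ℓ ∈ (y : ProjectiveSpectrum (MvPolynomial.homogeneousSubmodule (Fin (3 + 1)) k)).asHomogeneousIdeal}) →
      ∀ (ℓ₀ : MvPolynomial (Fin (3 + 1)) k), ℓ₀.IsHomogeneous 1 → ℓ₀ ≠ 0 →
        {y : (Literature.AlgebraicGeometry.Motives.projectiveSpace 3 k).left | ℓ ∈ (y : ProjectiveSpectrum (MvPolynomial.homogeneousSubmodule (Fin (3 + 1)) k)).asHomogeneousIdeal} =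
          {y : (Literature.AlgebraicGeometry.Motives.projectiveSpace 3 k).left | ℓ₀ ∈ (y : ProjectiveSpectrum (MvPolynomial.homogeneousSubmodule (Fin (3 + 1)) k)).asHomogeneousIdeal} →
        ∀ (Z : Set (Literature.AlgebraicGeometry.Motives.projectiveSpace 3 k).left) (hZ : IsClosed Z),
        Z ⊆ (Set.range ι) →
        ¬ ((Set.range ι) ⊆ Z) →
        Z.Infinite →
        Z ⊆ {y : (Literature.AlgebraicGeometry.Motives.projectiveSpace 3 k).left | ℓ ∈ (y : ProjectiveSpectrum (MvPolynomial.homogeneousSubmodule (Fin (3 + 1)) k)).asHomogeneousIdeal} →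
        IsPreirreducible Z →
        (∀ z : ↥(redSub (Literature.AlgebraicGeometry.Motives.projectiveSpace 3 k).left Z hZ), IsClosed ({z} : Set ↥(redSub (Literature.AlgebraicGeometry.Motives.projectiveSpace 3 k).left Z hZ)) →
              ringKrullDim ((redSub (Literature.AlgebraicGeometry.Motives.projectiveSpace 3 k).left Z hZ).presheaf.stalk z) = ((1 : ℕ) : WithBot ℕ∞)) →
        (∀ (i : redSub (Literature.AlgebraicGeometry.Motives.projectiveSpace 3 k).left Z hZ ⟶ redSub (Literature.AlgebraicGeometry.Motives.projectiveSpace 3 k).left Set.univ isClosed_univ), i ≫ redSubι (Literature.AlgebraicGeometry.Motives.projectiveSpace 3 k).left Set.univ isClosed_univ = redSubι (Literature.AlgebraicGeometry.Motives.projectiveSpace 3 k).left Z hZ →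
              ∀ z : ↥(redSub (Literature.AlgebraicGeometry.Motives.projectiveSpace 3 k).left Z hZ), IsRegularLocalRing ((redSub (Literature.AlgebraicGeometry.Motives.projectiveSpace 3 k).left Set.univ isClosed_univ).presheaf.stalk (i.base z))) →
        (∀ (i : redSub (Literature.AlgebraicGeometry.Motives.projectiveSpace 3 k).left Z hZ ⟶ redSub (Literature.AlgebraicGeometry.Motives.projectiveSpace 3 k).left (closure {y : (Literature.AlgebraicGeometry.Motives.projectiveSpace 3 k).left | ℓ ∈ (y : ProjectiveSpectrum (MvPolynomial.homogeneousSubmodule (Fin (3 + 1)) k)).asHomogeneousIdeal}) isClosed_closure),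
              i ≫ redSubι (Literature.AlgebraicGeometry.Motives.projectiveSpace 3 k).left (closure {y : (Literature.AlgebraicGeometry.Motives.projectiveSpace 3 k).left | ℓ ∈ (y : ProjectiveSpectrum (MvPolynomial.homogeneousSubmodule (Fin (3 + 1)) k)).asHomogeneousIdeal}) isClosed_closure = redSubι (Literature.AlgebraicGeometry.Motives.projectiveSpace 3 k).left Z hZ →
              ∀ z : ↥(redSub (Literature.AlgebraicGeometry.Motives.projectiveSpace 3 k).left Z hZ), IsRegularLocalRing ((redSub (Literature.AlgebraicGeometry.Motives.projectiveSpace 3 k).left (closure {y : (Literature.AlgebraicGeometry.Motives.projectiveSpace 3 k).left | ℓ ∈ (y : ProjectiveSpectrum (MvPolynomial.homogeneousSubmodule (Fin (3 + 1)) k)).asHomogeneousIdeal}) isClosed_closure).presheaf.stalk (i.base z))) →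
        (∀ e : ↥(redSub (Literature.AlgebraicGeometry.Motives.projectiveSpace 3 k).left (closure {y : (Literature.AlgebraicGeometry.Motives.projectiveSpace 3 k).left | ℓ ∈ (y : ProjectiveSpectrum (MvPolynomial.homogeneousSubmodule (Fin (3 + 1)) k)).asHomogeneousIdeal}) isClosed_closure),
              IsClosed ({e} : Set ↥(redSub (Literature.AlgebraicGeometry.Motives.projectiveSpace 3 k).left (closure {y : (Literature.AlgebraicGeometry.Motives.projectiveSpace 3 k).left | ℓ ∈ (y : ProjectiveSpectrum (MvPolynomial.homogeneousSubmodule (Fin (3 + 1)) k)).asHomogeneousIdeal}) isClosed_closure)) →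
              (redSubι (Literature.AlgebraicGeometry.Motives.projectiveSpace 3 k).left (closure {y : (Literature.AlgebraicGeometry.Motives.projectiveSpace 3 k).left | ℓ ∈ (y : ProjectiveSpectrum (MvPolynomial.homogeneousSubmodule (Fin (3 + 1)) k)).asHomogeneousIdeal}) isClosed_closure e : (Literature.AlgebraicGeometry.Motives.projectiveSpace 3 k).left) ∈ Z →
              ringKrullDim ((redSub (Literature.AlgebraicGeometry.Motives.projectiveSpace 3 k).left (closure {y : (Literature.AlgebraicGeometry.Motives.projectiveSpace 3 k).left | ℓ ∈ (y : ProjectiveSpectrum (MvPolynomial.homogeneousSubmodule (Fin (3 + 1)) k)).asHomogeneousIdeal}) isClosed_closure).presheaf.stalk e) = ((2 : ℕ) : WithBot ℕ∞)) →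
        EqCertAt₀ k 3 ℓ Z hZ →
        NoseDatum k O (AlgebraicGeometry.Proj (MvPolynomial.homogeneousSubmodule (Fin (3 + 1)) O)) (AlgebraicGeometry.Proj.toSpecZero (MvPolynomial.homogeneousSubmodule (Fin (3 + 1)) O) ≫ AlgebraicGeometry.Spec.map (CommRingCat.ofHom (algebraMap O (MvPolynomial.homogeneousSubmodule (Fin (3 + 1)) O 0)))) (Set.range (ι ≫ AlgebraicGeometry.Proj.map φ hφ' : H ⟶ (AlgebraicGeometry.Proj (MvPolynomial.homogeneousSubmodule (Fin (3 + 1)) O)))) (Literature.AlgebraicGeometry.Motives.projectiveSpace 3 k).left (AlgebraicGeometry.Proj (MvPolynomial.homogeneousSubmodule (Fin (3 + 1)) O)) (𝟙 (AlgebraicGeometry.Proj (MvPolynomial.homogeneousSubmodule (Fin (3 + 1)) O))) (AlgebraicGeometry.Proj.map φ hφ' : (Literature.AlgebraicGeometry.Motives.projectiveSpace 3 k).left ⟶ (AlgebraicGeometry.Proj (MvPolynomial.homogeneousSubmodule (Fin (3 + 1)) O))) {y : (Literature.AlgebraicGeometry.Motives.projectiveSpace 3 k).left | ℓ ∈ (y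 : ProjectiveSpectrum (MvPolynomial.homogeneousSubmodule (Fin (3 + 1)) k)).asHomogeneousIdeal} Z hZ) := by
  classical
  intro O _ _ _ _ _ θ hθ
  letI := MvPolynomial.gradedAlgebra (σ := Fin (3 + 1)) (R := O)
  letI := MvPolynomial.gradedAlgebra (σ := Fin (3 + 1)) (R := k)
  intro φ hφ' hφ hPint hPnoeth hPreg hqprop hqsm ℓ hnot ℓ₀ hℓ₀1 hℓ₀0 hV Z hZ hZT hTZ hZinf hZℓ hZirr hZdim hGreg hEreg hEdim hcert
  obtain ⟨e, δ, g, B, c, a, b, v, hg, hsq, hZeq, hℓB, ⟨r, hr, hdet⟩, hcab, hmarked, hcover, hsurj⟩ := hcert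
  haveI := hι
  haveI := hH
  -- units of `O` are detected by `θ`
  have hunit : ∀ x : O, θ x ≠ 0 → IsUnit x := by
    intro x hx
    by_contra h
    have hm : x ∈ IsLocalRing.maximalIdeal O := h
    rw [← ker_eq_maximalIdeal_of_surjective θ hθ] at hm
    exact hx hm
  -- the lifted hyperplane data and the equinodal lift
  obtain ⟨a₀, Bt, ct, Nt, ha₀, hBt, hdett, hcta₀, hψt, hsect, hkert, hψk, hkerk⟩ :=
    HyperplaneLift.exists_hyperplane_lift θ hθ hunit B r hr hdet
  obtain ⟨Gt, nO, hGt, hGtg, hnO, hn2, hnode, hHess⟩ :=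
    exists_equinodal_lift_of_cert_of_surjective θ hθ g hg B c a b hcab v hmarked hsurj
  -- `V₊(ℓ) = V₊(λ)`, `λ = θ L̃`
  have hdvd : (∑ a', C (θ (ct a')) * X a' : MvPolynomial (Fin (3 + 1)) k) ∣ ℓ := hkerk ℓ hℓB
  have hVlin := HostNormalForm.setOf_mem_eq_setOf_mem_linear (r := 2) (fun a' => θ (ct a')) a₀ (by simp only [hcta₀, map_one]) ℓ hdvd ℓ₀
    hℓ₀1 hℓ₀0 hV
  -- the two models' degree certificates
  set Lt : MvPolynomial (Fin (3 + 1)) O := ∑ a', C (ct a') * X a' with hLtdef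
  set Gh : MvPolynomial (Fin (3 + 1)) O := aeval (fun i : Fin 3 => ∑ j : Fin 3, C (Nt i j) * X (r j)) Gt with hGhdef
  have hLt1 : Lt.IsHomogeneous 1 := HyperplaneAlg.isHomogeneous_sum_C_mul_X ct id
  have hGhe : Gh.IsHomogeneous e :=
    HyperplaneAlg.isHomogeneous_aeval_linear _ (fun i => HyperplaneAlg.isHomogeneous_sum_C_mul_X _ _) Gt hGt
  have hL : ∀ l, (![Lt] : Fin 1 → MvPolynomial (Fin (3 + 1)) O) l ∈ homogeneousSubmodule (Fin (3 + 1)) O ((![1] : Fin 1 → ℕ) l) := by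
    intro l; fin_cases l; exact hLt1
  have hF : ∀ l, (![Lt, Gh] : Fin 2 → MvPolynomial (Fin (3 + 1)) O) l ∈ homogeneousSubmodule (Fin (3 + 1)) O ((![1, e] : Fin 2 → ℕ) l) := by
    intro l; fin_cases l
    · exact hLt1
    · exact hGhe
  -- the marked vectors are pairwise distinct ((CERT-EQ) is surjective onto `k^δ`)
  have hvinj : Function.Injective v := by
    intro i i' hvv
    by_contra hne
    obtain ⟨h, hh⟩ := hsurj (Pi.single i (1 : k))
    have h1 : MvPolynomial.eval (v i) (h : MvPolynomial (Fin 3) k) = 1 := by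
      have := congrFun hh i; simpa using this
    have h0 : MvPolynomial.eval (v i') (h : MvPolynomial (Fin 3) k) = 0 := by
      have := congrFun hh i'; simpa [Pi.single_eq_of_ne (Ne.symm hne)] using this
    rw [hvv, h0] at h1
    exact zero_ne_one h1
  -- THE SECTIONS CORE
  obtain ⟨m, 𝔰, w, hW5, hS1, hS2, hS3, hS4, hS5, hS6, hS7, hS8⟩ :=
    coreS O θ hθ φ hφ' hφ hPint hPnoeth hPreg hqprop hqsm ℓ Z hZ e δ g B c a b v r hg hsq hZeq hℓB hr hcab hmarked hcover hvinj a₀ Bt ct Nt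
      ha₀ hBt hdett hcta₀ hψt hsect hkert hVlin Gt nO hGt hGtg hnO hn2 hnode hHess hL hF
  -- THE LETTER `𝓛₀ = (![L̃])~`
  have hAB : {y : (Literature.AlgebraicGeometry.Motives.projectiveSpace 3 k).left |
        ℓ ∈ (y : ProjectiveSpectrum (MvPolynomial.homogeneousSubmodule (Fin (3 + 1)) k)).asHomogeneousIdeal} =
      {y : (Literature.AlgebraicGeometry.Motives.projectiveSpace 3 k).left |
        (∑ a', C (θ (ct a')) * X a' : MvPolynomial (Fin (3 + 1)) k) ∈
          (y : ProjectiveSpectrum (MvPolynomial.homogeneousSubmodule (Fin (3 + 1)) k)).asHomogeneousIdeal} :=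
    Set.ext fun y => Set.ext_iff.mp hVlin y
  have hH' : ¬ (Set.range ι ⊆ {y : (Literature.AlgebraicGeometry.Motives.projectiveSpace 3 k).left |
      (∑ a', C (θ (ct a')) * X a' : MvPolynomial (Fin (3 + 1)) k) ∈
        (y : ProjectiveSpectrum (MvPolynomial.homogeneousSubmodule (Fin (3 + 1)) k)).asHomogeneousIdeal}) := by
    rw [← hAB]; exact hnot
  haveI : @IsClosedImmersion H (Proj (homogeneousSubmodule (Fin (2 + 1 + 1)) k)) ι := hι
  obtain ⟨hl1, hl2, hl3, hl4, hl5⟩ := LetterModel.letter_clauses_projIdealSheaf (r := 2) θ hθ φ hφ hφ' ct a₀ 1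
    (by rw [hcta₀, one_mul]) _ (HyperplaneLift.map_sum_C_mul_X θ ct) H ι hH' hL
  have hl1' := hl1.trans (congrArg (fun S : Set (Literature.AlgebraicGeometry.Motives.projectiveSpace 3 k).left =>
    vanishingIdeal (⟨closure S, isClosed_closure⟩ : Closeds (Literature.AlgebraicGeometry.Motives.projectiveSpace 3 k).left)) hAB.symm)
  -- THE NOSE `𝓦₀ = (![L̃, Ĝ])~`: `𝓛₀ ≤ 𝓦₀`, flat
  have hW1 := NoseModel.letter_le_nose O Lt Gh e hL hF
  have hh0 : restrictToHyperplane B g ≠ 0 := hsq.ne_zero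
  have hGt0 : MvPolynomial.map θ Gt ≠ 0 := by rw [hGtg]; exact hh0
  have hW3 := NoseModel.flat_nose O θ hθ (MvPolynomial.aeval fun a' : Fin (3 + 1) => ∑ j : Fin 3, C (Bt a' j) * X j)
    (fun G => aeval (fun i : Fin 3 => ∑ j : Fin 3, C (Nt i j) * X (r j)) G) Lt hψt hsect hkert Gt hGt0 e hF
  -- the reduced trace `𝓘⟨Z⟩`
  set ψk : MvPolynomial (Fin (3 + 1)) k →ₐ[k] MvPolynomial (Fin 3) k := MvPolynomial.aeval fun a' : Fin (3 + 1) => ∑ j : Fin 3, C (B a' j) * X j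
    with hψkdef
  set σk : MvPolynomial (Fin 3) k → MvPolynomial (Fin (3 + 1)) k := fun G => aeval (fun i : Fin 3 => ∑ j : Fin 3, C (θ (Nt i j)) * X (r j)) G
    with hσkdef
  have hψσk : ∀ G, ψk (σk G) = G := by
    intro G
    obtain ⟨G', rfl⟩ := MvPolynomial.map_surjective θ hθ G
    change MvPolynomial.aeval _ (aeval _ (MvPolynomial.map θ G')) = _
    rw [← map_aeval_sect θ Nt r G', ← HyperplaneLift.map_aeval_linear θ Bt B hBt, hsect]
  set f : Fin 2 → MvPolynomial (Fin (3 + 1)) k := ![∑ a', C (θ (ct a')) * X a', σk (restrictToHyperplane B g)] with hfdef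
  have hφX : ∀ i : Fin (3 + 1), φ (X i) = X i := fun i => by rw [hφ, map_X]
  have hφF : ∀ l, φ ((![Lt, Gh] : Fin 2 → MvPolynomial (Fin (3 + 1)) O) l) = f l := by
    intro l; fin_cases l
    · change φ Lt = ∑ a', C (θ (ct a')) * X a'
      rw [hφ, hLtdef, HyperplaneLift.map_sum_C_mul_X]
    · change φ Gh = σk (restrictToHyperplane B g)
      rw [hφ, hGhdef, map_aeval_sect, hGtg]
  have hhe : (restrictToHyperplane B g).IsHomogeneous e := isHomogeneous_restrictToHyperplane B g hg
  have hf : ∀ l, f l ∈ homogeneousSubmodule (Fin (3 + 1)) k ((![1, e] : Fin 2 → ℕ) l) := by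
    intro l; fin_cases l
    · exact HyperplaneAlg.isHomogeneous_sum_C_mul_X (fun a' => θ (ct a')) id
    · exact HyperplaneAlg.isHomogeneous_aeval_linear _ (fun i => HyperplaneAlg.isHomogeneous_sum_C_mul_X _ _) _ hhe
  have hrad : (Ideal.span (Set.range f)).IsRadical :=
    NoseModel.isRadical_span_range_pair ψk.toRingHom σk _ hψk hψσk hkerk (restrictToHyperplane B g) hsq
  have hZf : Z = {y : Proj (homogeneousSubmodule (Fin (3 + 1)) k) | ∀ l, f l ∈ y.asHomogeneousIdeal} :=
    hZeq.trans (NoseModel.setOf_pair_eq ψk.toRingHom σk _ hψσk hkerk ℓ g hVlin)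
  have hW2 := NoseModel.comap_eq_vanishingIdeal_of_isRadical φ hφ' hφX ![Lt, Gh] f ![1, e] hF hf hφF hrad Z hZ hZf
  -- integrality (res-L1-w45b-stub-4 ✓ p679360) on the base model square
  have hP := ProjectiveAmbientFibre.isPullback_projMap θ φ hφ hθ hφ'
  haveI := hPnoeth
  haveI := hqprop
  have hW4 := FibreIntegral.isIntegral_subscheme_of_flat_of_comap_eq_vanishingIdeal O θ hθ _ _ _ hP _ Z hZ ⟨hZinf.nonempty, hZirr⟩ hW2 hW3
  -- assemble
  refine ⟨_, _, m, 𝔰, w, hl1', hl2, hl3, hl4, hl5, hW1, hW2, ?_, hW4, hW5, hS1, hS2, hS3, hS4, hS5, hS6, hS7, hS8⟩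
  rw [Category.id_comp]; exact hW3

end Summit.ResolutionOfSingularities.ResolutionOfSingularities.Cruxes.EquisingularLiftNat.Sections.Equinodal

end
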